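import Summits.CriticalPhenomena.PercolationContinuityZ3.Theorems.Transplant.FKConnectivityAllQAntipodalRootFormGenAttachPFacts
import Summits.CriticalPhenomena.PercolationContinuityZ3.Theorems.Transplant.FKConnectivityAllQAntipodalRootFormAttachS

/-!
# Connectivity correlation inequalities for `φ_{w,q}`, every `q > 0` — ROOT-FORM CALCULUS FOR ANY NUMBER OF SPECIALS, file 61ζ:
# general SERIES attachment of a special-free box, `B · 𝓔`, for pattern-indexed environments (port of file 61w to `Gen.EDat ι`)

Support file (`--supports stmt-CriticalPhenomena-4575`), FK sub-lane `prim-bschramm-fk-2` (gen 29); builds on p205010 (kernel theorem,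
internal audit signed; external expert review pending).  Definition `Gen.attS`; `scomb` and its kind lemmas are those of file 61w.
No named facts, no sorries; standard axioms.  Facts 1, 3, 4, 5 for `B · 𝓔` (fact 2 in file 61η). [folklore]
-/

noncomputable section

namespace Summit.CriticalPhenomena.PercolationContinuityZ3.Theorems

namespace FK

namespace RootForm

namespace Gen

open Finset Base

variable {ι : Type*} [Fintype ι] [DecidableEq ι]

/-- **The environment `B · 𝓔`** of an abstract special-free box in series with a two-special environment. (memo FROM-fk-2-g28-ROOT-FORM §3) -/
def attS {BB C : Type*} (B : BB → SDat) (E : Env ι C) : Env ι (BB × C) := fun p => ⟨fun P => scomb (B p.1) ((E p.2).d P)⟩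


section Facts

variable {BB C : Type*} [Fintype BB] [Preorder BB] [Fintype C] [Preorder C] (B : BB → SDat) (E : Env ι C)

omit [Fintype BB] [Preorder BB] [Fintype C] [Preorder C] in
set_option linter.unusedSimpArgs false in
/-- **Pointwise decomposition of the integrand of `B · 𝓔` by kind.** [folklore] -/
theorem gattS_integrand_kind (H0 H1 : BB × C → ℝ) (J : ℤ) (β : BB) (γ : C) :
    H1 (β, γ) * (attS B E (β, γ)).gslot1 J + H0 (β, γ) * (attS B E (β, γ)).gslot0 J =
      kd (B β) true true * (H1 (β, γ) * (E γ).gslot1 (J - (B β).L) + H0 (β, γ) * (E γ).gslot0 (J - (B β).L))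
      + kd (B β) false false * ((H1 (β, γ) + H0 (β, γ)) * (E γ).gandDel (J - (B β).L))
      + kd (B β) true false * (H1 (β, γ) * (serE E (true, γ)).gslot1 (J - (B β).L) + H0 (β, γ) * (serE E (true, γ)).gslot0 (J - (B β).L))
      + kd (B β) false true * (H1 (β, γ) * (serE E (false, γ)).gslot1 (J - (B β).L) + H0 (β, γ) * (serE E (false, γ)).gslot0 (J - (B β).L)) := by
  cases hc : (B β).c <;> cases hcb : (B β).cb
  · have h := gintegrands_of_addLam (serE (serE E) (true, (false, γ))) (attS B E (β, γ)) (B β).L (fun P => scomb_of_kind00 _ _ hc hcb) J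
    rw [h.1, h.2.1]
    simp only [serE, EDat.gslot1_ser_true, EDat.gslot0_ser_true, EDat.gslot1_ser_false, EDat.gandDel_ser, kd, hc, hcb, Bool.true_eq_false,
      Bool.false_eq_true, and_self, and_true, and_false, true_and, false_and, if_true, if_false]; ring
  · have h := gintegrands_of_addLam (serE E (false, γ)) (attS B E (β, γ)) (B β).L (fun P => scomb_of_kind01 _ _ hc hcb) J
    rw [h.1, h.2.1]
    simp only [kd, hc, hcb, Bool.true_eq_false, Bool.false_eq_true, and_self, and_true, and_false, true_and, false_and, if_true,
      if_false]; ring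
  · have h := gintegrands_of_addLam (serE E (true, γ)) (attS B E (β, γ)) (B β).L (fun P => scomb_of_kind10 _ _ hc hcb) J
    rw [h.1, h.2.1]
    simp only [kd, hc, hcb, Bool.true_eq_false, Bool.false_eq_true, and_self, and_true, and_false, true_and, false_and, if_true,
      if_false]; ring
  · have h := gintegrands_of_addLam (E γ) (attS B E (β, γ)) (B β).L (fun P => scomb_of_kind11 _ _ hc hcb) J
    rw [h.1, h.2.1]
    simp only [kd, hc, hcb, Bool.true_eq_false, Bool.false_eq_true, and_self, and_true, and_false, true_and, false_and, if_true,
      if_false]; ring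

/-- **Fact 1 for `B · 𝓔`.** [folklore] -/
theorem gattS_Mt_nonneg
    (hU : ∀ h : BB → ℝ, Monotone h → (∀ β, 0 ≤ h β) → ∀ K : ℤ,
      0 ≤ ∑ β, h β * ((if (B β).L = K then (1 : ℝ) else 0) * (kd (B β) true false - kd (B β) false true)))
    (f1 : ∀ h0 h1 : C → ℝ, Monotone h0 → Monotone h1 → (∀ γ, 0 ≤ h0 γ) → (∀ γ, h0 γ ≤ h1 γ) → ∀ J : ℤ, 0 ≤ gMt E h0 h1 J)
    (f3 : ∀ h : C → ℝ, Monotone h → (∀ γ, 0 ≤ h γ) → ∀ J : ℤ, 0 ≤ ∑ γ, h γ * (E γ).gandDel J)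
    {H0 H1 : BB × C → ℝ} (m0 : Monotone H0) (m1 : Monotone H1) (n0 : ∀ p, 0 ≤ H0 p) (le : ∀ p, H0 p ≤ H1 p) (J : ℤ) :
    0 ≤ gMt (attS B E) H0 H1 J := by
  have n1 : ∀ p, 0 ≤ H1 p := fun p => (n0 p).trans (le p)
  have R := regroup B H0 H1 (fun γ J => (serE E (true, γ)).gslot1 J) (fun γ J => (serE E (true, γ)).gslot0 J)
    (fun γ J => (serE E (false, γ)).gslot1 J) (fun γ J => (serE E (false, γ)).gslot0 J) J
  have RM : ∀ K, ∑ γ, (aggW B K H1 (true, γ) * (serE E (true, γ)).gslot1 (J - K) + aggW B K H0 (true, γ) * (serE E (true, γ)).gslot0 (J - K)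
      + (aggW B K H1 (false, γ) * (serE E (false, γ)).gslot1 (J - K) + aggW B K H0 (false, γ) * (serE E (false, γ)).gslot0 (J - K))) =
      gMt (serE E) (aggW B K H0) (aggW B K H1) (J - K) := fun K => by
    unfold gMt; rw [sum_bool_prod, ← Finset.sum_add_distrib]
  unfold gMt
  rw [Fintype.sum_prod_type]
  simp_rw [gattS_integrand_kind B E H0 H1 J]
  simp only [Finset.sum_add_distrib]
  rw [add_assoc, R]
  refine add_nonneg (add_nonneg (Finset.sum_nonneg fun β _ => ?_) (Finset.sum_nonneg fun β _ => ?_)) (Finset.sum_nonneg fun K _ => ?_)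
  · rw [← Finset.mul_sum]
    exact mul_nonneg (kd_nonneg _ _ _) (f1 _ _ (mono_right m0 β) (mono_right m1 β) (fun γ => n0 _) (fun γ => le _) _)
  · rw [← Finset.mul_sum]
    exact mul_nonneg (kd_nonneg _ _ _) (f3 _ ((mono_right m1 β).add (mono_right m0 β)) (fun γ => add_nonneg (n1 _) (n0 _)) _)
  · rw [RM]
    exact gMt_ser_nonneg f1 f3 (aggW_mono B hU m0 n0 K) (aggW_mono B hU m1 n1 K) (aggW_nonneg B n0 K) (aggW_le B le K) _

omit [Fintype BB] [Preorder BB] [Fintype C] [Preorder C] in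
/-- **Deleted AND of `B · 𝓔`**: every kind is the deleted AND of `𝓔`. [folklore] -/
theorem gandDel_attS (β : BB) (γ : C) (J : ℤ) : (attS B E (β, γ)).gandDel J = (E γ).gandDel (J - (B β).L) := by
  have h : ∀ d : PDat, (scomb (B β) d).adel J = d.adel (J - (B β).L) := fun d => ind_congr (by simp only [scomb]; omega)
  simp only [EDat.gandDel, attS, h]

omit [Fintype BB] [Preorder BB] [Fintype C] [Preorder C] in
/-- **Contracted AND of `B · 𝓔` by kind.** [folklore] -/
theorem gandCon_attS (β : BB) (γ : C) (J : ℤ) :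
    (attS B E (β, γ)).gandCon J = kd (B β) true true * (E γ).gandCon (J - (B β).L) + kd (B β) false false * (E γ).gandDel (J - (B β).L)
      + kd (B β) true false * (E γ).gandE1 (J - (B β).L) + kd (B β) false true * (E γ).gandE2 (J - (B β).L) := by
  have h : ∀ d : PDat, (scomb (B β) d).acon J = kd (B β) true true * d.acon (J - (B β).L) + kd (B β) false false * d.adel (J - (B β).L)
      + kd (B β) true false * d.a1 (J - (B β).L) + kd (B β) false true * d.a2 (J - (B β).L) := fun d => by
    obtain ⟨L, c, cb⟩ := B β; obtain ⟨l, k1, k2⟩ := d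
    cases c <;> cases cb <;> cases k1 <;> cases k2 <;> simp [scomb, kd, PDat.adel, PDat.acon, PDat.a1, PDat.a2] <;>
      first | rfl | exact ind_congr (by omega)
  simp only [EDat.gandDel, EDat.gandCon, EDat.gandE1, EDat.gandE2, attS, h]; ring

omit [Fintype BB] [Preorder BB] [Fintype C] [Preorder C] in
/-- **Free nested AND of `B · 𝓔` by kind.** [folklore] -/
theorem gandE_attS (β : BB) (γ : C) (J : ℤ) :
    (attS B E (β, γ)).gandE1 J = kd (B β) true true * (E γ).gandE1 (J - (B β).L) + kd (B β) false false * (E γ).gandDel (J - (B β).L)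
      + kd (B β) true false * (E γ).gandE1 (J - (B β).L) + kd (B β) false true * (E γ).gandDel (J - (B β).L) ∧
    (attS B E (β, γ)).gandE2 J = kd (B β) true true * (E γ).gandE2 (J - (B β).L) + kd (B β) false false * (E γ).gandDel (J - (B β).L)
      + kd (B β) true false * (E γ).gandDel (J - (B β).L) + kd (B β) false true * (E γ).gandE2 (J - (B β).L) := by
  have h1 : ∀ d : PDat, (scomb (B β) d).a1 J = kd (B β) true true * d.a1 (J - (B β).L) + kd (B β) false false * d.adel (J - (B β).L)
      + kd (B β) true false * d.a1 (J - (B β).L) + kd (B β) false true * d.adel (J - (B β).L) := fun d => by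
    obtain ⟨L, c, cb⟩ := B β; obtain ⟨l, k1, k2⟩ := d
    cases c <;> cases cb <;> cases k1 <;> cases k2 <;> simp [scomb, kd, PDat.adel, PDat.a1] <;> exact ind_congr (by omega)
  have h2 : ∀ d : PDat, (scomb (B β) d).a2 J = kd (B β) true true * d.a2 (J - (B β).L) + kd (B β) false false * d.adel (J - (B β).L)
      + kd (B β) true false * d.adel (J - (B β).L) + kd (B β) false true * d.a2 (J - (B β).L) := fun d => by
    obtain ⟨L, c, cb⟩ := B β; obtain ⟨l, k1, k2⟩ := d
    cases c <;> cases cb <;> cases k1 <;> cases k2 <;> simp [scomb, kd, PDat.adel, PDat.a2] <;> exact ind_congr (by omega)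
  simp only [EDat.gandE1, EDat.gandE2, EDat.gandDel, attS, h1, h2]; constructor <;> ring

/-- **Fact 3 for `B · 𝓔`.** [folklore] -/
theorem gattS_andDel_nonneg (f3 : ∀ h : C → ℝ, Monotone h → (∀ γ, 0 ≤ h γ) → ∀ J : ℤ, 0 ≤ ∑ γ, h γ * (E γ).gandDel J)
    (h : BB × C → ℝ) (mh : Monotone h) (nh : ∀ p, 0 ≤ h p) (J : ℤ) : 0 ≤ ∑ p, h p * (attS B E p).gandDel J := by
  rw [Fintype.sum_prod_type]
  refine Finset.sum_nonneg fun β _ => ?_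
  simp only [gandDel_attS]
  exact f3 _ (mono_right mh β) (fun γ => nh _) _

/-- **Fact 4 for `B · 𝓔`.** [folklore] -/
theorem gattS_andCon_nonneg
    (hU : ∀ h : BB → ℝ, Monotone h → (∀ β, 0 ≤ h β) → ∀ K : ℤ,
      0 ≤ ∑ β, h β * ((if (B β).L = K then (1 : ℝ) else 0) * (kd (B β) true false - kd (B β) false true)))
    (f3 : ∀ h : C → ℝ, Monotone h → (∀ γ, 0 ≤ h γ) → ∀ J : ℤ, 0 ≤ ∑ γ, h γ * (E γ).gandDel J)
    (f4 : ∀ h : C → ℝ, Monotone h → (∀ γ, 0 ≤ h γ) → ∀ J : ℤ, 0 ≤ ∑ γ, h γ * (E γ).gandCon J)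
    (f5 : ∀ h0 h1 : C → ℝ, Monotone h0 → Monotone h1 → (∀ γ, 0 ≤ h0 γ) → (∀ γ, h0 γ ≤ h1 γ) → ∀ J : ℤ,
      0 ≤ ∑ γ, (h1 γ * (E γ).gandE1 J + h0 γ * (E γ).gandE2 J))
    (h : BB × C → ℝ) (mh : Monotone h) (nh : ∀ p, 0 ≤ h p) (J : ℤ) : 0 ≤ ∑ p, h p * (attS B E p).gandCon J := by
  have R := regroup B h h (fun γ J => (E γ).gandE1 J) (fun _ _ => 0) (fun _ _ => 0) (fun γ J => (E γ).gandE2 J) J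
  simp only [mul_zero, add_zero, zero_add] at R
  have hsplit : ∑ p, h p * (attS B E p).gandCon J =
      ∑ β, ∑ γ, kd (B β) true true * (h (β, γ) * (E γ).gandCon (J - (B β).L))
      + ∑ β, ∑ γ, kd (B β) false false * (h (β, γ) * (E γ).gandDel (J - (B β).L))
      + (∑ β, ∑ γ, kd (B β) true false * (h (β, γ) * (E γ).gandE1 (J - (B β).L))
        + ∑ β, ∑ γ, kd (B β) false true * (h (β, γ) * (E γ).gandE2 (J - (B β).L))) := by
    rw [Fintype.sum_prod_type]
    simp only [gandCon_attS, ← Finset.sum_add_distrib]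
    exact Finset.sum_congr rfl fun β _ => Finset.sum_congr rfl fun γ _ => by ring
  rw [hsplit, R]
  refine add_nonneg (add_nonneg (Finset.sum_nonneg fun β _ => ?_) (Finset.sum_nonneg fun β _ => ?_)) (Finset.sum_nonneg fun K _ => ?_)
  · rw [← Finset.mul_sum]; exact mul_nonneg (kd_nonneg _ _ _) (f4 _ (mono_right mh β) (fun γ => nh _) _)
  · rw [← Finset.mul_sum]; exact mul_nonneg (kd_nonneg _ _ _) (f3 _ (mono_right mh β) (fun γ => nh _) _)
  · have hm := aggW_mono B hU mh nh K
    exact f5 _ _ (mono_sec hm false) (mono_sec hm true) (fun γ => aggW_nonneg B nh K _) (fun γ => sec_le hm γ) _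

/-- **Fact 5 for `B · 𝓔`.** [folklore] -/
theorem gattS_andFree_nonneg
    (hU : ∀ h : BB → ℝ, Monotone h → (∀ β, 0 ≤ h β) → ∀ K : ℤ,
      0 ≤ ∑ β, h β * ((if (B β).L = K then (1 : ℝ) else 0) * (kd (B β) true false - kd (B β) false true)))
    (f3 : ∀ h : C → ℝ, Monotone h → (∀ γ, 0 ≤ h γ) → ∀ J : ℤ, 0 ≤ ∑ γ, h γ * (E γ).gandDel J)
    (f5 : ∀ h0 h1 : C → ℝ, Monotone h0 → Monotone h1 → (∀ γ, 0 ≤ h0 γ) → (∀ γ, h0 γ ≤ h1 γ) → ∀ J : ℤ,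
      0 ≤ ∑ γ, (h1 γ * (E γ).gandE1 J + h0 γ * (E γ).gandE2 J))
    (h0 h1 : BB × C → ℝ) (m0 : Monotone h0) (m1 : Monotone h1) (n0 : ∀ p, 0 ≤ h0 p) (le : ∀ p, h0 p ≤ h1 p) (J : ℤ) :
    0 ≤ ∑ p, (h1 p * (attS B E p).gandE1 J + h0 p * (attS B E p).gandE2 J) := by
  have n1 : ∀ p, 0 ≤ h1 p := fun p => (n0 p).trans (le p)
  have R := regroup B h0 h1 (fun γ J => (E γ).gandE1 J) (fun _ _ => 0) (fun _ _ => 0) (fun γ J => (E γ).gandE2 J) J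
  simp only [mul_zero, add_zero, zero_add] at R
  have hsplit : ∑ p, (h1 p * (attS B E p).gandE1 J + h0 p * (attS B E p).gandE2 J) =
      ∑ β, ∑ γ, kd (B β) true true * (h1 (β, γ) * (E γ).gandE1 (J - (B β).L) + h0 (β, γ) * (E γ).gandE2 (J - (B β).L))
      + ∑ β, ∑ γ, kd (B β) false false * ((h1 (β, γ) + h0 (β, γ)) * (E γ).gandDel (J - (B β).L))
      + ∑ β, ∑ γ, (kd (B β) true false * h0 (β, γ) + kd (B β) false true * h1 (β, γ)) * (E γ).gandDel (J - (B β).L)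
      + (∑ β, ∑ γ, kd (B β) true false * (h1 (β, γ) * (E γ).gandE1 (J - (B β).L))
        + ∑ β, ∑ γ, kd (B β) false true * (h0 (β, γ) * (E γ).gandE2 (J - (B β).L))) := by
    rw [Fintype.sum_prod_type]
    simp only [← Finset.sum_add_distrib]
    refine Finset.sum_congr rfl fun β _ => Finset.sum_congr rfl fun γ _ => ?_
    obtain ⟨e1, e2⟩ := gandE_attS B E β γ J
    rw [e1, e2]; ring
  rw [hsplit, R]
  refine add_nonneg (add_nonneg (add_nonneg (Finset.sum_nonneg fun β _ => ?_) (Finset.sum_nonneg fun β _ => ?_))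
    (Finset.sum_nonneg fun β _ => ?_)) (Finset.sum_nonneg fun K _ => ?_)
  · rw [← Finset.mul_sum]
    exact mul_nonneg (kd_nonneg _ _ _) (f5 _ _ (mono_right m0 β) (mono_right m1 β) (fun γ => n0 _) (fun γ => le _) _)
  · rw [← Finset.mul_sum]
    exact mul_nonneg (kd_nonneg _ _ _) (f3 _ ((mono_right m1 β).add (mono_right m0 β)) (fun γ => add_nonneg (n1 _) (n0 _)) _)
  · exact f3 _ (((mono_right m0 β).const_mul (kd_nonneg _ _ _)).add ((mono_right m1 β).const_mul (kd_nonneg _ _ _)))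
      (fun γ => add_nonneg (mul_nonneg (kd_nonneg _ _ _) (n0 _)) (mul_nonneg (kd_nonneg _ _ _) (n1 _))) _
  · have hm0 := aggW_mono B hU m0 n0 K
    have hm1 := aggW_mono B hU m1 n1 K
    exact f5 _ _ (mono_sec hm0 false) (mono_sec hm1 true) (fun γ => aggW_nonneg B n0 K _)
      (fun γ => (sec_le hm0 γ).trans (aggW_le B le K _)) _

end Facts

end Gen

end RootForm

end FK

end Summit.CriticalPhenomena.PercolationContinuityZ3.Theorems

end
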